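import Literature.AlgebraicGeometry.Motives.AbelianVarietySimpleOfIsogenyAnyField
import Literature.AlgebraicGeometry.Motives.AbelianVarietyPoincarePerfectField
import HarnessLib

/-!
# Every abelian subvariety is, up to isogeny, the image of an integral quasi-idempotent endomorphism
# (the "norm endomorphism" `N_Y = h ∘ i` of a quasi-retraction; Mumford §19 Thm. 1, Milne 1986 Prop. 12.1,
# Birkenhake–Lange §5.3)

Family `hodge`, layer `Literature/AlgebraicGeometry/Motives`; KERNEL ONLY (theorems; no definition, no instance, no
named fact; net debt 0).  §1 holds over an ARBITRARY field, §2 over a PERFECT field.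

THE PRINT.  Milne, *Abelian Varieties* (in Cornell–Silverman 1986), §12 Prop. 12.1 (PDF p. 189): for an abelian
subvariety `B ⊂ A` there is `B' ⊂ A` with `B ∩ B'` finite and `B + B' = A`; §8 (PDF p. 181): «`n_A` factors as
`n_A = g ∘ f` with `g` an isogeny».  Mumford, *Abelian Varieties* (1970), §19 Thm. 1 (p. 173) and its proof: the
complement is cut out by an endomorphism built from a polarisation, and (p. 174, «The structure of `End⁰(X)`») abelian
subvarieties of `X` correspond to idempotents of `End⁰(X)`.  Birkenhake–Lange, *Complex Abelian Varieties*, §5.3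
(norm-endomorphism criterion, Prop. 5.3.4 / Cor. 5.3.6 over `ℂ`): the norm endomorphism `N_Y` of an abelian
subvariety `Y` satisfies `N_Y² = e(Y) N_Y` and `Im N_Y = Y`.  Kani–Rosen, *Idempotent relations and factors of
Jacobians*, Math. Ann. 284 (1989), §2: abelian subvarieties as images `ε(A)` of (quasi-)idempotents.

THE ROUTE HERE (kernel-free).  Let `i : Y ↪ X` be a closed-immersion homomorphism with a QUASI-RETRACTION
`h : X → Y`, `i ≫ h = [N]_Y`, `N ≠ 0` (over a perfect field every abelian subvariety has one:
`exists_quasiRetraction_of_perfectField`, `Motives/AbelianVarietyPoincarePerfectField`, Galois descent of a Poincaré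
complement).  Put `u := h ≫ i : X → X` ("first `h`, then `i`", i.e. `u = i ∘ h`).  Then `u ≫ u = N • u` and `h` is
surjective, and the homomorphism `g := i ≫ (X ↠ im u) : Y → im u` satisfies `g ≫ (im u ↪ X) = i ≫ u = N • i`
(finite: a closed immersion followed by the isogeny `[N]`), so `g` is FINITE (cancellation,
`Motives/AbelianVarietySimpleOfIsogenyAnyField`), and `h ≫ g = N • (X ↠ im u)` is surjective, so `g` is SURJECTIVE:
**`g : Y → im (h ≫ i)` is an isogeny, `Y ∼ im (h ≫ i)`, `dim im (h ≫ i) = dim Y`.**  Consequently every statement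
of the tree about images `u(X)` of integral quasi-idempotents `u² = a u` (the Kani–Rosen engine
`Motives/AbelianVarietyIdempotentRelations`, the isotypic criteria of `HodgeTheory/…CrossedProductIsotypic*`) applies
to arbitrary abelian subvarieties over a perfect field.

Results (namespace `Literature.AlgebraicGeometry.Motives.AbelianVariety`):
* §1 (any field; `hih : i ≫ h = N • 𝟙 Y`, `N ≠ 0`): `comp_self_eq_nsmul_of_quasiRetraction` (`u ≫ u = N • u`),
  `surjective_of_quasiRetraction`, `comp_comp_toImage_eq_nsmul_of_quasiRetraction` (`h ≫ g = N • (X ↠ im u)`),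
  `comp_toImage_comp_imageι_of_quasiRetraction` (`g ≫ (im u ↪ X) = N • i`), `isFinite_comp_toImage_of_quasiRetraction`,
  `surjective_comp_toImage_of_quasiRetraction`, **`isIsogeny_comp_toImage_of_quasiRetraction`**,
  **`isIsogenous_image_of_quasiRetraction`** (`Y ∼ im (h ≫ i)`), **`dim_image_of_quasiRetraction`**;
* §2 (perfect field; any closed immersion `i : Y ↪ X`): **`exists_quasiIdempotent_isIsogenous_image`** (there are
  `u : X → X`, `N ≠ 0` with `u ≫ u = N • u`, `Y ∼ im u` and `dim im u = dim Y`),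
  `exists_quasiIdempotent_dim_image_eq`.

## References
* [Milne1986AbelianVarieties] J. S. Milne, in Cornell–Silverman, *Arithmetic Geometry* (1986), §8 (PDF p. 181),
  §12 Prop. 12.1 (PDF p. 189).
* [MumfordAV1970] D. Mumford, *Abelian Varieties* (1970), §19 Thm. 1 and pp. 173–174.
* [LangeBirkenhake1992] H. Lange, Ch. Birkenhake, *Complex Abelian Varieties* (1992), §5.3 (norm-endomorphism
  criterion).
* [KaniRosen1989] E. Kani, M. Rosen, *Idempotent relations and factors of Jacobians*, Math. Ann. 284 (1989), §2.
-/

noncomputable section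

universe u

open CategoryTheory CategoryTheory.Limits AlgebraicGeometry

namespace Literature.AlgebraicGeometry.Motives.AbelianVariety

variable {K : Type u} [Field K]

/-! ## §1 The norm endomorphism `u = h ≫ i` of a quasi-retraction (any field) -/

section QuasiRetraction

variable {X Y : AbelianVariety K} {i : Y ⟶ X} {h : X ⟶ Y} {N : ℕ}

/-- **`u ≫ u = N • u`** for `u = h ≫ i` and a quasi-retraction `i ≫ h = [N]_Y`: the norm endomorphism of an
abelian subvariety is an integral quasi-idempotent («`N_Y² = e(Y) N_Y`»).
[cite: LangeBirkenhake1992, §5.3 (norm-endomorphism criterion)] [cite: MumfordAV1970, §19 p. 174 (idempotents of `End⁰(X)`)] -/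
theorem comp_self_eq_nsmul_of_quasiRetraction (hih : i ≫ h = N • 𝟙 Y) :
    (h ≫ i) ≫ (h ≫ i) = N • (h ≫ i) := by
  rw [Category.assoc, ← Category.assoc i h, hih, Preadditive.nsmul_comp, Category.id_comp,
    Preadditive.comp_nsmul]

/-- A quasi-retraction `h` (`i ≫ h = [N]_Y`, `N ≠ 0`) is surjective. [cite: Milne1986AbelianVarieties, §8 (PDF p. 181: «n_A factors as g ∘ f with g an isogeny»)] -/
theorem surjective_of_quasiRetraction (hN : N ≠ 0) (hih : i ≫ h = N • 𝟙 Y) :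
    Surjective (Hom.toSchemeHom h) :=
  surjective_of_comp_eq_nsmul_id hN hih

/-- `h ≫ (i ≫ (X ↠ im u)) = N • (X ↠ im u)` for `u = h ≫ i` (cancel the monomorphism `im u ↪ X`: both sides
composed with it give `h ≫ i ≫ u = N • u`). [cite: LangeBirkenhake1992, §5.3] [cite: MumfordAV1970, §19 Thm. 1 (p. 173)] -/
theorem comp_comp_toImage_eq_nsmul_of_quasiRetraction (hih : i ≫ h = N • 𝟙 Y) :
    h ≫ (i ≫ toImage (h ≫ i)) = N • toImage (h ≫ i) := by
  haveI := mono_of_isClosedImmersion_toSchemeHom (imageι (h ≫ i))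
  refine (cancel_mono (imageι (h ≫ i))).1 ?_
  have h1 : (h ≫ i ≫ toImage (h ≫ i)) ≫ imageι (h ≫ i) = (h ≫ i) ≫ (h ≫ i) := by
    simp only [Category.assoc, toImage_imageι]
  have h2 : (N • toImage (h ≫ i)) ≫ imageι (h ≫ i) = N • (h ≫ i) := by
    rw [Preadditive.nsmul_comp, toImage_imageι]
  rw [h1, h2]
  exact comp_self_eq_nsmul_of_quasiRetraction hih

/-- `(i ≫ (X ↠ im u)) ≫ (im u ↪ X) = N • i` for `u = h ≫ i`. [cite: LangeBirkenhake1992, §5.3] [cite: MumfordAV1970, §19 Thm. 1 (p. 173)] -/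
theorem comp_toImage_comp_imageι_of_quasiRetraction (hih : i ≫ h = N • 𝟙 Y) :
    (i ≫ toImage (h ≫ i)) ≫ imageι (h ≫ i) = N • i := by
  rw [Category.assoc, toImage_imageι, ← Category.assoc, hih, Preadditive.nsmul_comp, Category.id_comp]

/-- **`g = i ≫ (X ↠ im u) : Y → im u` is finite**: `g ≫ (im u ↪ X) = N • i = i ≫ [N]_X` is a closed immersion
followed by an isogeny, hence finite, and finite morphisms cancel against the separated `im u ↪ X`.
[cite: Milne1986AbelianVarieties, §8 Prop. 8.1 (PDF p. 180)] [cite: MumfordAV1970, §19 Thm. 1 (p. 173)] -/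
theorem isFinite_comp_toImage_of_quasiRetraction [IsClosedImmersion (Hom.toSchemeHom i)] (hN : N ≠ 0)
    (hih : i ≫ h = N • 𝟙 Y) : IsFinite (Hom.toSchemeHom (i ≫ toImage (h ≫ i))) := by
  haveI : IsFinite (Hom.toSchemeHom ((i ≫ toImage (h ≫ i)) ≫ imageι (h ≫ i))) := by
    rw [comp_toImage_comp_imageι_of_quasiRetraction hih,
      show N • i = i ≫ (N • 𝟙 X) by rw [Preadditive.comp_nsmul, Category.comp_id]]
    haveI := (isIsogeny_nsmul_id_of_ne_zero X hN).2
    exact isFinite_toSchemeHom_comp i (N • 𝟙 X)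
  exact isFinite_of_isFinite_comp (i ≫ toImage (h ≫ i)) (imageι (h ≫ i))

/-- **`g = i ≫ (X ↠ im u) : Y → im u` is surjective**: `h ≫ g = N • (X ↠ im u) = (X ↠ im u) ≫ [N]` is surjective.
[cite: Milne1986AbelianVarieties, §12 Prop. 12.1 (PDF p. 189)] [cite: LangeBirkenhake1992, §5.3 («Im N_Y = Y»)] -/
theorem surjective_comp_toImage_of_quasiRetraction (hN : N ≠ 0) (hih : i ≫ h = N • 𝟙 Y) :
    Surjective (Hom.toSchemeHom (i ≫ toImage (h ≫ i))) := by
  haveI : Surjective (Hom.toSchemeHom (h ≫ (i ≫ toImage (h ≫ i)))) := by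
    rw [comp_comp_toImage_eq_nsmul_of_quasiRetraction hih,
      show N • toImage (h ≫ i) = toImage (h ≫ i) ≫ (N • 𝟙 (image (h ≫ i))) by
        rw [Preadditive.comp_nsmul, Category.comp_id]]
    haveI := (isIsogeny_nsmul_id_of_ne_zero (image (h ≫ i)) hN).1
    change Surjective (Hom.toSchemeHom (toImage (h ≫ i)) ≫ Hom.toSchemeHom (N • 𝟙 (image (h ≫ i))))
    infer_instance
  exact surjective_of_surjective_comp h _

/-- **`Y → im (h ≫ i)` is an isogeny** for an abelian subvariety `i : Y ↪ X` with quasi-retraction `h`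
(`i ≫ h = [N]_Y`, `N ≠ 0`), over any field: finite and surjective.
[cite: Milne1986AbelianVarieties, §8 Prop. 8.1 and §12 Prop. 12.1 (PDF pp. 180, 189)] [cite: LangeBirkenhake1992, §5.3 («Im N_Y = Y»)] -/
theorem isIsogeny_comp_toImage_of_quasiRetraction [IsClosedImmersion (Hom.toSchemeHom i)] (hN : N ≠ 0)
    (hih : i ≫ h = N • 𝟙 Y) : IsIsogeny (i ≫ toImage (h ≫ i)) :=
  ⟨surjective_comp_toImage_of_quasiRetraction hN hih, isFinite_comp_toImage_of_quasiRetraction hN hih⟩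

/-- **`Y ∼ im (h ≫ i)`**: an abelian subvariety with a quasi-retraction is isogenous to the image of its norm
endomorphism (any field). [cite: LangeBirkenhake1992, §5.3 (norm-endomorphism criterion, «Im N_Y = Y»)]
[cite: MumfordAV1970, §19 Thm. 1 and p. 174] [cite: KaniRosen1989, §2] -/
theorem isIsogenous_image_of_quasiRetraction [IsClosedImmersion (Hom.toSchemeHom i)] (hN : N ≠ 0)
    (hih : i ≫ h = N • 𝟙 Y) : IsIsogenous Y (image (h ≫ i)) :=
  ⟨i ≫ toImage (h ≫ i), isIsogeny_comp_toImage_of_quasiRetraction hN hih⟩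

/-- `dim im (h ≫ i) = dim Y` for an abelian subvariety `i : Y ↪ X` with quasi-retraction `h`.
[cite: LangeBirkenhake1992, §5.3] [cite: MumfordAV1970, §19 Thm. 1 (p. 173)] -/
theorem dim_image_of_quasiRetraction [IsClosedImmersion (Hom.toSchemeHom i)] (hN : N ≠ 0)
    (hih : i ≫ h = N • 𝟙 Y) : (image (h ≫ i)).dim = Y.dim :=
  (dim_eq_of_isIsogeny (isIsogeny_comp_toImage_of_quasiRetraction hN hih)).symm

end QuasiRetraction

/-! ## §2 Perfect field: every abelian subvariety is the image of a quasi-idempotent, up to isogeny -/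

section Perfect

variable [PerfectField K] {X Y : AbelianVariety K}

/-- **Every abelian subvariety of an abelian variety over a perfect field is isogenous to the image `u(X)` of an
integral quasi-idempotent endomorphism `u` (`u ≫ u = N • u`, `N ≠ 0`) with `dim u(X) = dim Y`** — namely
`u = h ≫ i` for a quasi-retraction `h` of `i : Y ↪ X` (Poincaré's reducibility over a perfect field,
`exists_quasiRetraction_of_perfectField`).  Through this, the tree's results on images of quasi-idempotents
(Kani–Rosen engine, isotypic criteria) apply to arbitrary abelian subvarieties.
[cite: Milne1986AbelianVarieties, §12 Prop. 12.1 (PDF p. 189)] [cite: MumfordAV1970, §19 Thm. 1 and p. 174]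
[cite: LangeBirkenhake1992, §5.3] [cite: KaniRosen1989, §2] -/
theorem exists_quasiIdempotent_isIsogenous_image (i : Y ⟶ X) [IsClosedImmersion (Hom.toSchemeHom i)] :
    ∃ (u : X ⟶ X) (N : ℕ), N ≠ 0 ∧ u ≫ u = N • u ∧ IsIsogenous Y (image u) ∧ (image u).dim = Y.dim := by
  obtain ⟨h, N, hN, hih⟩ := exists_quasiRetraction_of_perfectField i
  exact ⟨h ≫ i, N, hN, comp_self_eq_nsmul_of_quasiRetraction hih, isIsogenous_image_of_quasiRetraction hN hih,
    dim_image_of_quasiRetraction hN hih⟩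

/-- The dimension of every abelian subvariety of `X` (perfect field) is the dimension of the image of an integral
quasi-idempotent endomorphism of `X`. [cite: Milne1986AbelianVarieties, §12 Prop. 12.1 (PDF p. 189)] [cite: KaniRosen1989, §2] -/
theorem exists_quasiIdempotent_dim_image_eq (i : Y ⟶ X) [IsClosedImmersion (Hom.toSchemeHom i)] :
    ∃ (u : X ⟶ X) (N : ℕ), N ≠ 0 ∧ u ≫ u = N • u ∧ (image u).dim = Y.dim := by
  obtain ⟨u, N, hN, hu, -, hd⟩ := exists_quasiIdempotent_isIsogenous_image i
  exact ⟨u, N, hN, hu, hd⟩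

end Perfect

end Literature.AlgebraicGeometry.Motives.AbelianVariety

end
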